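import Literature.ModelTheory.Zilber.EACDensityPhases
import Literature.ModelTheory.Zilber.EACDensityCrossed
import Literature.ModelTheory.Zilber.EACMonomialChange
import Literature.ModelTheory.Zilber.EACPeriodicReduction
import HarnessLib

/-!
# Mantova–Masser's unprojected-density question is invariant under `GL₂(ℤ) ⋉ ℂ²`: transport of
# the case hypotheses and of the answer under lattice changes `(x, y) ↦ (U x, y^U)` and
# translations `(x, y) ↦ (x + b, e^{b} y)`; the index swap; lines as bases

Literature module (Zilber's Exponential-Algebraic-Closedness programme, `EC(3,2)` ladder node
"density of unprojected exponential points").  HONEST FRAMING: as in the other `EACDensity*` files,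
this concerns the auxiliary question of Mantova–Masser [MantovaMasser2023, §1 Further remarks,
p. 5] (typed in `EACDensityQuestion` as `MMCaseDimPiOneFree W → UnprojectedDense W`, refuted as
literally typed in `EACDensityOscillatory`, repaired by adding multiplicative freeness and OPEN in
that form).  It is a modest structural rung far below Zilber's conjecture, which is NOT Schanuel's
conjecture and does not imply it; `EC(3,2)` stays OPEN; nothing here is evidence for either.

## What this file proves (all unconditional, no `sorry`)

Parts 1–3 (lattice changes, any `n` where stated).  For an integer matrix `U` with inverse `V`
the lattice change `Φ_U (x, y) = (U x, y^U)` of `EACMonomialChange` maps the graph of `exp` to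
itself, and `W ↦ W^U := cl Φ_U(W ∩ Gⁿ)` (`latticeClosure U W`) moves irreducible closed
subvarieties of `ℂⁿ × ℂⁿ` meeting the torus around.  Added to the transport kit of
`EACMonomialChange` (closedness, irreducibility, dimension, `addProjDim`, freeness):
* **density of the exponential points transports**: `unprojectedDense_latticeClosure`
  (`I(W ∩ Γ) = I(W) ⇒ I(W^U ∩ Γ) = I(W^U)`, `W` closed) and `unprojectedDense_latticeClosure_iff`
  (irreducible closed `W` meeting `Gⁿ`).  The one idea: clear denominators
  (`exists_mul_prod_pow_eq_aeval`: `f(Φ_U z)·(∏ yⱼ)^N = a(z)` on `Gⁿ`); `a` vanishes on `W ∩ Γ`,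
  hence on `W`, hence `f` on `Φ_U(W ∩ Gⁿ)`.
* **the closure of the base transports** (`zeroLocus_vanishingIdeal_image_intLinMap`) and **lines
  of rational slope pull back** (`isRationalSlopeLine_of_image_intLinMap`), so **Mantova–Masser's
  case (dim-pi-S-1-free) transports** (`mmCaseDimPiOneFree_latticeClosure`, `n = 2`), with
  multiplicative freeness (`isMulFree_latticeClosure_inter`).  Every decided instance — positive or
  negative, free or not — yields the decided instance `W^U` for every `U ∈ GL₂(ℤ)`
  (`densityInstance_latticeClosure`, `densityCounterexample_latticeClosure`,
  `freeDensityInstance_latticeClosure_iff`).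

Parts 4–5 (the index swap).  `(x₀, x₁, y₀, y₁) ↦ (x₁, x₀, y₁, y₀)` made explicit (`idxSwap`,
`indexSwapped W = {z | z ∘ idxSwap ∈ W}`, `latticeClosure_idxSwapMat : W^{(0 1; 1 0)} =
indexSwapped W`), with `unprojectedDense_indexSwapped_iff` for EVERY `W` (no hypotheses: `rename`)
and `mmCaseDimPiOneFree_indexSwapped`.  Applications to graphs over `x₁`: the crossed-family
theorem of `EACDensityCrossed` transfers to `{x₀ = p(x₁), y₁ = q(y₀)}`
(`densityInstance_indexSwapped_crossed`); the resonant parabola's negative answer transfers to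
`{x₀ = x₁²/(2πi), y₁ = 1}` (`densityCounterexample_indexSwapped_resonantParabola`).

Parts 6–7 (coordinate changes in general; translations).  A bijection of `K^ι` realised by an
algebra automorphism of `K[X_ι]` moves vanishing ideals, zero loci, closures, closedness,
irreducibility and dimension (`…_of_subst`), and density of exponential points when it maps `Γ_exp`
into itself (`unprojectedDense_image_of_subst`).  Instance: the translation
`τ_b (x, y) = (x + b, e^{b} y)` (`expTransl`, substitution `translSubst`, automorphism
`translSubstEquiv`): `unprojectedDense_image_expTransl_iff`, `mmCaseDimPiOneFree_image_expTransl`,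
`isMulFree_image_expTransl_inter`, `densityInstance_image_expTransl`,
`densityCounterexample_image_expTransl`.  With Parts 1–3: the typed question is an invariant of
the `GL₂(ℤ) ⋉ ℂ²`-orbit of `W`.

Part 8 (explicit targets).  `latticeClosure_eq_of_latticeImage_eq` (recognition lemma); the shear
`(1 0; m 1)`: `{x₁ = p(x₀), y₀ = c}^{(1 0; m 1)} = {x₁ = p(x₀) + m x₀, y₀ = c}`
(`latticeClosure_shearMat_graphPolySurface_C`, hence `unprojectedDense_graphPolySurface_add_intMul_iff`);
the translate `τ_{(β,0)} {x₁ = p(x₀), y₀ = c} = {x₁ = p(x₀ - β), y₀ = e^{β} c}`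
(`image_expTransl_graphPolySurface_C`, hence `unprojectedDense_graphPolySurface_comp_sub_iff`).

Part 9 (lines as bases).  `{x₁ = a x₀ + β, y₀ = q(y₁)}` (`q ≠ 0`) is in case (dim-pi-S-1-free)
iff `a ∉ ℚ` (`mmCase_graphPolySurface_line_iff`; `EACDensityFamilies` had `Im a ≠ 0` only).

Part 10 (through the phase criterion of `EACDensityPhases`).  Constant fibres over `x₁` completely
decided (`unprojectedDense_indexSwapped_const_iff`, `…_iff_infinite`, certificate
`mmCase_indexSwapped_graphPolySurface_C`); and **lines with constant fibres**: `{x₁ = a x₀ + β,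
y₀ = e^{z₀}}` is dense iff `a ∉ ℚ` (`unprojectedDense_line_const_iff`) — so in this family the
case condition and the answer COINCIDE (`mmCase_iff_unprojectedDense_line_const`), in particular
lines of REAL IRRATIONAL slope with constant fibres are positive instances
(`unprojectedDensityQuestion_instance_line_const`).  Still OPEN: lines of real irrational slope
with non-constant curve fibres `y₀ = q(y₁)` (common zeros of two exponential polynomials), non-graph
shapes, and the free question for a general surface of the case — hence `EC(3,2)`.

Sources: [MantovaMasser2023] V. Mantova, D. Masser, arXiv:2303.05592, Thm. 1.2 (p. 4: the case
list is visibly `GL₂(ℤ)`-invariant — "line of rational slope"), §1 Further remarks (p. 5); the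
lattice change is Zilber's `[M]` [Zilber2005, §2] as typed in `ExpVarieties` / `EACMonomialChange`;
automorphisms of tori and of `(𝔾ₐ × 𝔾ₘ)ⁿ` respecting `exp` are standard (e.g. Bombieri–Gubler,
Heights, Ch. 3).  Elementary and presumably folklore; no claim of priority.
-/

noncomputable section

open MvPolynomial Matrix Complex

namespace Literature.ModelTheory.Zilber

open Literature.NumberTheory.Transcendental
open Literature.ModelTheory.ExponentialFields

/-! ## Part 1 — density of the exponential points under `Φ_U` (any `n`) -/

section General

variable {n : ℕ}

/-- **Core lemma.** If `I(W ∩ Γ_exp) = I(W)` and `Φ_U(W ∩ Gⁿ) ⊆ W'`, then every polynomial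
vanishing on `W' ∩ Γ_exp` vanishes on `Φ_U(W ∩ Gⁿ)`: clearing denominators,
`f(Φ_U z)·(∏ⱼ yⱼ)^N = a(z)` on the torus; `a` vanishes on `W ∩ Γ_exp` (because `Φ_U` preserves
`Γ_exp`), hence on `W`, hence `f(Φ_U z₀) = 0` for `z₀ ∈ W ∩ Gⁿ`. [folklore] -/
theorem vanishingIdeal_inter_expGraph_le_latticeImage (U : Matrix (Fin n) (Fin n) ℤ)
    {W W' : Set (Fin n ⊕ Fin n → ℂ)} (hW : UnprojectedDense W) (hsub : latticeImage U W ⊆ W') :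
    vanishingIdeal ℂ (W' ∩ expGraph ℂ n) ≤ vanishingIdeal ℂ (latticeImage U W) := by
  intro f hf
  rw [mem_vanishingIdeal_iff]
  rintro _ ⟨z₀, ⟨hz₀W, hz₀T⟩, rfl⟩
  obtain ⟨N, a, hNa⟩ := exists_mul_prod_pow_eq_aeval U f
  have ha : a ∈ vanishingIdeal ℂ (W ∩ expGraph ℂ n) := by
    rw [mem_vanishingIdeal_iff]
    rintro z ⟨hzW, hzΓ⟩
    have hzT : z ∈ torusLocus ℂ n := expGraph_subset_torusLocus hzΓ
    have hUz : latticeChange U z ∈ W' ∩ expGraph ℂ n :=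
      ⟨hsub ⟨z, ⟨hzW, hzT⟩, rfl⟩, latticeChange_mem_expGraph hzΓ⟩
    rw [← hNa z hzT, ← latticeChange_eq_matrixAct, (mem_vanishingIdeal_iff.1 hf) _ hUz, zero_mul]
  have hW' : vanishingIdeal ℂ (W ∩ expGraph ℂ n) = vanishingIdeal ℂ W := hW
  rw [hW'] at ha
  have h0 : aeval z₀ a = 0 := (mem_vanishingIdeal_iff.1 ha) z₀ hz₀W
  have h1 := hNa z₀ hz₀T
  rw [h0, ← latticeChange_eq_matrixAct] at h1
  exact (mul_eq_zero.1 h1).resolve_right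
    (pow_ne_zero _ (Finset.prod_ne_zero_iff.2 fun i _ => hz₀T i))

/-- **Transport of `UnprojectedDense` to an explicit target.** If `I(W ∩ Γ) = I(W)`, `W'` has torus
part exactly `Φ_U(W ∩ Gⁿ)` and that torus part is Zariski dense in `W'` (`I(W' ∩ Gⁿ) = I(W')`),
then `I(W' ∩ Γ) = I(W')`. [folklore] -/
theorem unprojectedDense_of_latticeImage (U : Matrix (Fin n) (Fin n) ℤ)
    {W W' : Set (Fin n ⊕ Fin n → ℂ)} (hW : UnprojectedDense W)
    (hT : W' ∩ torusLocus ℂ n = latticeImage U W)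
    (hW' : vanishingIdeal ℂ (W' ∩ torusLocus ℂ n) = vanishingIdeal ℂ W') :
    UnprojectedDense W' := by
  unfold UnprojectedDense
  refine le_antisymm ?_ (vanishingIdeal_anti_mono Set.inter_subset_left)
  rw [← hW', hT]
  exact vanishingIdeal_inter_expGraph_le_latticeImage U hW (hT ▸ Set.inter_subset_left)

/-- **`W ↦ W^U` preserves density of the exponential points** (`U` invertible over `ℤ`, `W`
closed). [folklore] -/
theorem unprojectedDense_latticeClosure {U V : Matrix (Fin n) (Fin n) ℤ} (hUV : U * V = 1)
    (hVU : V * U = 1) {W : Set (Fin n ⊕ Fin n → ℂ)} (hWc : IsZariskiClosed ℂ W)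
    (hW : UnprojectedDense W) : UnprojectedDense (latticeClosure U W) :=
  unprojectedDense_of_latticeImage U hW (latticeClosure_inter_torusLocus hUV hVU hWc)
    (by rw [latticeClosure_inter_torusLocus hUV hVU hWc, vanishingIdeal_latticeClosure])

/-- **… and reflects it** for an irreducible closed `W` meeting the torus (go back with `V`:
`Φ_V(W^U ∩ Gⁿ) = W ∩ Gⁿ`, dense in `W`). [folklore] -/
theorem unprojectedDense_latticeClosure_iff {U V : Matrix (Fin n) (Fin n) ℤ} (hUV : U * V = 1)
    (hVU : V * U = 1) {W : Set (Fin n ⊕ Fin n → ℂ)} (hW : IsIrreducibleClosed ℂ W)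
    (hne : (W ∩ torusLocus ℂ n).Nonempty) :
    UnprojectedDense (latticeClosure U W) ↔ UnprojectedDense W := by
  refine ⟨fun h => ?_, unprojectedDense_latticeClosure hUV hVU hW.1⟩
  have hVimg : latticeImage V (latticeClosure U W) = W ∩ torusLocus ℂ n := by
    rw [latticeImage_congr_inter V ((latticeClosure_inter_torusLocus hUV hVU hW.1).trans
      (latticeImage_inter_torusLocus U W).symm), latticeImage_latticeImage_of_mul_eq_one hVU]
  exact unprojectedDense_of_latticeImage V h hVimg.symm
    (vanishingIdeal_inter_torusLocus_of_irred hW hne)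

/-- Multiplicative freeness of the torus part transports to `W^U` (inverse pair, `W` closed).
[folklore] -/
theorem isMulFree_latticeClosure_inter {U V : Matrix (Fin n) (Fin n) ℤ} (hUV : U * V = 1)
    (hVU : V * U = 1) {W : Set (Fin n ⊕ Fin n → ℂ)} (hWc : IsZariskiClosed ℂ W)
    (hmul : IsMulFree ℂ n (W ∩ torusLocus ℂ n)) :
    IsMulFree ℂ n (latticeClosure U W ∩ torusLocus ℂ n) := by
  rw [latticeClosure_inter_torusLocus hUV hVU hWc]
  exact isMulFree_latticeImage hUV hmul

/-! ## Part 2 — the base: closures and lines under `x ↦ U x` -/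

variable {K : Type*} [Field K]

/- `zeroLocus_vanishingIdeal_image_intLinMap` (`cl (U·B) = U · cl B`) is imported from
`EACPeriodicReduction`. -/

/-- **Lines of rational slope pull back under `x ↦ U x`** (`U ∈ GL₂(ℤ)`): if `U · L` is the line
`m · x = c` (`m ∈ ℤ² ∖ 0`) then `L` is the line `(m U) · x = c`, and `m U ≠ 0`. [folklore] -/
theorem isRationalSlopeLine_of_image_intLinMap {U V : Matrix (Fin 2) (Fin 2) ℤ}
    (hUV : U * V = 1) (hVU : V * U = 1) {L : Set (Fin 2 → K)}
    (h : IsRationalSlopeLine (intLinMap U '' L)) : IsRationalSlopeLine L := by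
  obtain ⟨m, hm, c, hc⟩ := h
  refine ⟨Matrix.vecMul m U, vecMul_ne_zero_of_mul_eq_one hUV hm, c, ?_⟩
  have key : ∀ x : Fin 2 → K,
      ((Matrix.vecMul m U 0 : ℤ) : K) * x 0 + ((Matrix.vecMul m U 1 : ℤ) : K) * x 1 =
        (m 0 : K) * intLinMap U x 0 + (m 1 : K) * intLinMap U x 1 := fun x => by
    have e := sum_mul_intLinMap (K := K) m U x
    simp only [Fin.sum_univ_two] at e
    exact e.symm
  ext x
  simp only [Set.mem_setOf_eq]
  constructor
  · intro hx
    have h1 : intLinMap U x ∈ intLinMap U '' L := ⟨x, hx, rfl⟩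
    rw [hc, Set.mem_setOf_eq] at h1
    rw [key]
    exact h1
  · intro hx
    rw [key] at hx
    have h1 : intLinMap U x ∈ intLinMap U '' L := by
      rw [hc, Set.mem_setOf_eq]
      exact hx
    obtain ⟨x', hx', he⟩ := h1
    have hxx : x' = x := by
      have h2 := congrArg (intLinMap V) he
      rwa [intLinMap_intLinMap_of_mul_eq_one hVU, intLinMap_intLinMap_of_mul_eq_one hVU] at h2
    exact hxx ▸ hx'

end General

/-! ## Part 3 — Mantova–Masser's case (dim-pi-S-1-free) transports, and the question with it -/

section CaseTransport

/-- `addProjDim` only sees the torus part. [folklore] -/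
theorem addProjDim_congr_inter {n : ℕ} {W₁ W₂ : Set (Fin n ⊕ Fin n → ℂ)}
    (h : W₁ ∩ torusLocus ℂ n = W₂ ∩ torusLocus ℂ n) : addProjDim ℂ n W₁ = addProjDim ℂ n W₂ := by
  unfold addProjDim
  rw [h]

/-- **Case (dim-pi-S-1-free) is `GL₂(ℤ)`-invariant**: if `W` is an irreducible surface meeting
`G²` with `dim cl π(W) = 1` and `cl π(W)` not a line of rational slope, then so is `W^U` for every
`U ∈ GL₂(ℤ)`. [folklore] -/
theorem mmCaseDimPiOneFree_latticeClosure {U V : Matrix (Fin 2) (Fin 2) ℤ} (hUV : U * V = 1)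
    (hVU : V * U = 1) {W : Set (Fin 2 ⊕ Fin 2 → ℂ)} (h : MMCaseDimPiOneFree W) :
    MMCaseDimPiOneFree (latticeClosure U W) := by
  obtain ⟨hW, hne, hdim, hapd, hline⟩ := h
  have hT : latticeClosure U W ∩ torusLocus ℂ 2 = latticeImage U W :=
    latticeClosure_inter_torusLocus hUV hVU hW.1
  refine ⟨isIrreducibleClosed_latticeClosure U hW hne, latticeClosure_inter_torusLocus_nonempty U hne,
    (zariskiDim_latticeClosure hUV hVU hW hne).trans hdim, ?_, ?_⟩
  · rw [addProjDim_congr_inter (hT.trans (latticeImage_inter_torusLocus U W).symm),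
      addProjDim_latticeImage hUV hVU, hapd]
  · rw [hT, projAdd_image_latticeImage, zeroLocus_vanishingIdeal_image_intLinMap hUV hVU]
    exact fun h' => hline (isRationalSlopeLine_of_image_intLinMap hUV hVU h')

/-- **A decided positive instance transports along its `GL₂(ℤ)`-orbit.** [folklore] -/
theorem densityInstance_latticeClosure {U V : Matrix (Fin 2) (Fin 2) ℤ} (hUV : U * V = 1)
    (hVU : V * U = 1) {W : Set (Fin 2 ⊕ Fin 2 → ℂ)}
    (h : MMCaseDimPiOneFree W ∧ UnprojectedDense W) :
    MMCaseDimPiOneFree (latticeClosure U W) ∧ UnprojectedDense (latticeClosure U W) :=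
  ⟨mmCaseDimPiOneFree_latticeClosure hUV hVU h.1, unprojectedDense_latticeClosure hUV hVU h.1.1.1 h.2⟩

/-- **A decided negative instance transports along its `GL₂(ℤ)`-orbit.** [folklore] -/
theorem densityCounterexample_latticeClosure {U V : Matrix (Fin 2) (Fin 2) ℤ} (hUV : U * V = 1)
    (hVU : V * U = 1) {W : Set (Fin 2 ⊕ Fin 2 → ℂ)}
    (h : MMCaseDimPiOneFree W ∧ ¬ UnprojectedDense W) :
    MMCaseDimPiOneFree (latticeClosure U W) ∧ ¬ UnprojectedDense (latticeClosure U W) :=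
  ⟨mmCaseDimPiOneFree_latticeClosure hUV hVU h.1,
    fun h' => h.2 ((unprojectedDense_latticeClosure_iff hUV hVU h.1.1 h.1.2.1).1 h')⟩

/-- **The repaired (free) question is `GL₂(ℤ)`-invariant instance-wise**: the hypotheses
"case (dim-pi-S-1-free) and multiplicatively free torus part" and the conclusion "exponential points
Zariski dense" are simultaneously transported to `W^U`.  (The free question itself — an inline
hypothesis elsewhere, never asserted — stays OPEN.) [folklore] -/
theorem freeDensityInstance_latticeClosure_iff {U V : Matrix (Fin 2) (Fin 2) ℤ} (hUV : U * V = 1)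
    (hVU : V * U = 1) {W : Set (Fin 2 ⊕ Fin 2 → ℂ)} (h : MMCaseDimPiOneFree W)
    (hmul : IsMulFree ℂ 2 (W ∩ torusLocus ℂ 2)) :
    (MMCaseDimPiOneFree (latticeClosure U W) ∧
        IsMulFree ℂ 2 (latticeClosure U W ∩ torusLocus ℂ 2)) ∧
      (UnprojectedDense (latticeClosure U W) ↔ UnprojectedDense W) :=
  ⟨⟨mmCaseDimPiOneFree_latticeClosure hUV hVU h, isMulFree_latticeClosure_inter hUV hVU h.1.1 hmul⟩,
    unprojectedDense_latticeClosure_iff hUV hVU h.1 h.2.1⟩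

end CaseTransport

/-! ## Part 4 — the index swap `(x₀, x₁, y₀, y₁) ↦ (x₁, x₀, y₁, y₀)` -/

section IndexSwapDefs

variable {K : Type*}

/-- The index swap on `Fin 2 ⊕ Fin 2`: `inl i ↦ inl (swap i)`, `inr i ↦ inr (swap i)`. [folklore] -/
def idxSwap : Fin 2 ⊕ Fin 2 → Fin 2 ⊕ Fin 2 :=
  Sum.map (Equiv.swap (0 : Fin 2) 1) (Equiv.swap (0 : Fin 2) 1)

/-- `σ(x₀) = x₁`. [folklore] -/
@[simp] theorem idxSwap_inl_zero : idxSwap (Sum.inl 0) = Sum.inl 1 := by simp [idxSwap]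
/-- `σ(x₁) = x₀`. [folklore] -/
@[simp] theorem idxSwap_inl_one : idxSwap (Sum.inl 1) = Sum.inl 0 := by simp [idxSwap]
/-- `σ(y₀) = y₁`. [folklore] -/
@[simp] theorem idxSwap_inr_zero : idxSwap (Sum.inr 0) = Sum.inr 1 := by simp [idxSwap]
/-- `σ(y₁) = y₀`. [folklore] -/
@[simp] theorem idxSwap_inr_one : idxSwap (Sum.inr 1) = Sum.inr 0 := by simp [idxSwap]

/-- On additive indices. [folklore] -/
theorem idxSwap_inl (i : Fin 2) : idxSwap (Sum.inl i) = Sum.inl (Equiv.swap (0 : Fin 2) 1 i) := rfl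

/-- On multiplicative indices. [folklore] -/
theorem idxSwap_inr (i : Fin 2) : idxSwap (Sum.inr i) = Sum.inr (Equiv.swap (0 : Fin 2) 1 i) := rfl

/-- `idxSwap` is an involution. [folklore] -/
@[simp] theorem idxSwap_idxSwap (k : Fin 2 ⊕ Fin 2) : idxSwap (idxSwap k) = k := by
  rcases k with i | i <;> simp [idxSwap, Equiv.swap_apply_self]

/-- Hence `(z ∘ idxSwap) ∘ idxSwap = z`. [folklore] -/
@[simp] theorem comp_idxSwap_comp_idxSwap {α : Type*} (z : Fin 2 ⊕ Fin 2 → α) :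
    (z ∘ idxSwap) ∘ idxSwap = z :=
  funext fun k => by simp

/-- **The index-swapped set** `W^σ = {z | z ∘ σ ∈ W}` (the image = preimage of `W` under the
involution `z ↦ z ∘ σ` of `K² × K²`). [folklore] -/
def indexSwapped (W : Set (Fin 2 ⊕ Fin 2 → K)) : Set (Fin 2 ⊕ Fin 2 → K) :=
  {z | z ∘ idxSwap ∈ W}

/-- Membership. [folklore] -/
@[simp] theorem mem_indexSwapped_iff {W : Set (Fin 2 ⊕ Fin 2 → K)} {z : Fin 2 ⊕ Fin 2 → K} :
    z ∈ indexSwapped W ↔ z ∘ idxSwap ∈ W :=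
  Iff.rfl

/-- `indexSwapped` is an involution. [folklore] -/
@[simp] theorem indexSwapped_indexSwapped (W : Set (Fin 2 ⊕ Fin 2 → K)) :
    indexSwapped (indexSwapped W) = W := by
  ext z
  simp

/-- `indexSwapped` commutes with intersections. [folklore] -/
theorem indexSwapped_inter (A B : Set (Fin 2 ⊕ Fin 2 → K)) :
    indexSwapped (A ∩ B) = indexSwapped A ∩ indexSwapped B :=
  rfl

end IndexSwapDefs

section IndexSwap

variable {K : Type*} [Field K]

/-- The torus locus is swap-invariant. [folklore] -/
@[simp] theorem indexSwapped_torusLocus : indexSwapped (torusLocus K 2) = torusLocus K 2 := by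
  ext z
  simp only [mem_indexSwapped_iff, mem_torusLocus_iff, Function.comp_apply, idxSwap_inr,
    Fin.forall_fin_two, Equiv.swap_apply_left, Equiv.swap_apply_right]
  exact and_comm

/-- The graph of `exp` is swap-invariant. [folklore] -/
@[simp] theorem indexSwapped_expGraph : indexSwapped (expGraph ℂ 2) = expGraph ℂ 2 := by
  ext z
  simp only [mem_indexSwapped_iff, mem_expGraph_iff, Function.comp_apply, idxSwap_inr, idxSwap_inl,
    Fin.forall_fin_two, Equiv.swap_apply_left, Equiv.swap_apply_right]
  exact and_comm

/-- **Vanishing ideals under the swap**: `f ∈ I(W^σ) ↔ rename σ f ∈ I(W)`. [folklore] -/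
theorem mem_vanishingIdeal_indexSwapped_iff (W : Set (Fin 2 ⊕ Fin 2 → K))
    (f : MvPolynomial (Fin 2 ⊕ Fin 2) K) :
    f ∈ vanishingIdeal K (indexSwapped W) ↔ rename idxSwap f ∈ vanishingIdeal K W := by
  simp only [mem_vanishingIdeal_iff, aeval_rename, mem_indexSwapped_iff]
  constructor
  · intro h z hz
    have h1 := h (z ∘ idxSwap) (by rw [comp_idxSwap_comp_idxSwap]; exact hz)
    exact h1
  · intro h z hz
    have h1 := h (z ∘ idxSwap) hz
    rwa [comp_idxSwap_comp_idxSwap] at h1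

/-- The swap of a Zariski closed set is Zariski closed (`Z(I)^σ = Z(rename σ (I))`). [folklore] -/
theorem isZariskiClosed_indexSwapped {W : Set (Fin 2 ⊕ Fin 2 → K)} (hW : IsZariskiClosed K W) :
    IsZariskiClosed K (indexSwapped W) := by
  obtain ⟨I, rfl⟩ := hW
  refine ⟨I.map (rename idxSwap), ?_⟩
  ext z
  rw [Ideal.map, zeroLocus_span, mem_indexSwapped_iff, mem_zeroLocus_iff, Set.mem_setOf_eq]
  constructor
  · rintro hz _ ⟨q, hq, rfl⟩
    rw [aeval_rename]
    exact hz q hq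
  · intro hz q hq
    have h := hz (rename idxSwap q) ⟨q, hq, rfl⟩
    rwa [aeval_rename] at h

/-- **Density of the exponential points is swap-invariant — for every `W`, no hypotheses.**
[folklore] -/
theorem unprojectedDense_indexSwapped {W : Set (Fin 2 ⊕ Fin 2 → ℂ)} (h : UnprojectedDense W) :
    UnprojectedDense (indexSwapped W) := by
  have h' : vanishingIdeal ℂ (W ∩ expGraph ℂ 2) = vanishingIdeal ℂ W := h
  show vanishingIdeal ℂ (indexSwapped W ∩ expGraph ℂ 2) = vanishingIdeal ℂ (indexSwapped W)
  have e : indexSwapped W ∩ expGraph ℂ 2 = indexSwapped (W ∩ expGraph ℂ 2) := by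
    rw [indexSwapped_inter, indexSwapped_expGraph]
  ext f
  rw [e, mem_vanishingIdeal_indexSwapped_iff, mem_vanishingIdeal_indexSwapped_iff, h']

/-- … as an equivalence. [folklore] -/
theorem unprojectedDense_indexSwapped_iff (W : Set (Fin 2 ⊕ Fin 2 → ℂ)) :
    UnprojectedDense (indexSwapped W) ↔ UnprojectedDense W :=
  ⟨fun h => by simpa using unprojectedDense_indexSwapped h, unprojectedDense_indexSwapped⟩

/-- The swap matrix `(0 1; 1 0) ∈ GL₂(ℤ)`. [folklore] -/
def idxSwapMat : Matrix (Fin 2) (Fin 2) ℤ := !![0, 1; 1, 0]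

/-- It is its own inverse. [folklore] -/
theorem idxSwapMat_mul_idxSwapMat : idxSwapMat * idxSwapMat = 1 := by
  simp [idxSwapMat, Matrix.one_fin_two]

/-- **The lattice change of the swap matrix IS the index swap** (on all of `K² × K²`: the
exponents are `0, 1`, so no junk values occur). [folklore] -/
theorem latticeChange_idxSwapMat (z : Fin 2 ⊕ Fin 2 → K) :
    latticeChange idxSwapMat z = z ∘ idxSwap := by
  funext k
  rcases k with i | i
  · rw [latticeChange_inl]
    fin_cases i <;>
      simp [intLinMap, idxSwapMat, Fin.sum_univ_two, projAdd_apply]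
  · rw [latticeChange_inr]
    fin_cases i <;>
      simp [monomialMap, idxSwapMat, Fin.prod_univ_two, projMul_apply]

/-- `Φ_σ(S ∩ G²) = (S ∩ G²)^σ`. [folklore] -/
theorem latticeImage_idxSwapMat (S : Set (Fin 2 ⊕ Fin 2 → K)) :
    latticeImage idxSwapMat S = indexSwapped (S ∩ torusLocus K 2) := by
  ext z
  simp only [latticeImage, Set.mem_image, latticeChange_idxSwapMat, mem_indexSwapped_iff]
  constructor
  · rintro ⟨w, hw, rfl⟩
    rwa [comp_idxSwap_comp_idxSwap]
  · intro hz
    exact ⟨z ∘ idxSwap, hz, comp_idxSwap_comp_idxSwap z⟩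

/-- **`W^{(0 1; 1 0)} = W^σ`** for an irreducible closed `W` meeting the torus (the torus part of
`W` is dense in `W`, and the swap is a homeomorphism). [folklore] -/
theorem latticeClosure_idxSwapMat {W : Set (Fin 2 ⊕ Fin 2 → K)} (hW : IsIrreducibleClosed K W)
    (hne : (W ∩ torusLocus K 2).Nonempty) : latticeClosure idxSwapMat W = indexSwapped W := by
  unfold latticeClosure
  rw [latticeImage_idxSwapMat]
  have e : vanishingIdeal K (indexSwapped (W ∩ torusLocus K 2)) = vanishingIdeal K (indexSwapped W) := by
    ext f
    rw [mem_vanishingIdeal_indexSwapped_iff, mem_vanishingIdeal_indexSwapped_iff,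
      vanishingIdeal_inter_torusLocus_of_irred hW hne]
  rw [e]
  exact zeroLocus_vanishingIdeal_of_isZariskiClosed (isZariskiClosed_indexSwapped hW.1)

/-- **Case (dim-pi-S-1-free) is swap-invariant.** [folklore] -/
theorem mmCaseDimPiOneFree_indexSwapped {W : Set (Fin 2 ⊕ Fin 2 → ℂ)} (h : MMCaseDimPiOneFree W) :
    MMCaseDimPiOneFree (indexSwapped W) := by
  rw [← latticeClosure_idxSwapMat h.1 h.2.1]
  exact mmCaseDimPiOneFree_latticeClosure idxSwapMat_mul_idxSwapMat idxSwapMat_mul_idxSwapMat h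

/-- Multiplicative freeness of the torus part is swap-invariant. [folklore] -/
theorem isMulFree_indexSwapped_inter {W : Set (Fin 2 ⊕ Fin 2 → ℂ)}
    (hmul : IsMulFree ℂ 2 (W ∩ torusLocus ℂ 2)) :
    IsMulFree ℂ 2 (indexSwapped W ∩ torusLocus ℂ 2) := by
  have e : indexSwapped W ∩ torusLocus ℂ 2 = latticeImage idxSwapMat W := by
    rw [latticeImage_idxSwapMat, indexSwapped_inter, indexSwapped_torusLocus]
  rw [e]
  exact isMulFree_latticeImage idxSwapMat_mul_idxSwapMat hmul

/-- Positive instances swap. [folklore] -/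
theorem densityInstance_indexSwapped {W : Set (Fin 2 ⊕ Fin 2 → ℂ)}
    (h : MMCaseDimPiOneFree W ∧ UnprojectedDense W) :
    MMCaseDimPiOneFree (indexSwapped W) ∧ UnprojectedDense (indexSwapped W) :=
  ⟨mmCaseDimPiOneFree_indexSwapped h.1, unprojectedDense_indexSwapped h.2⟩

/-- Negative instances swap. [folklore] -/
theorem densityCounterexample_indexSwapped {W : Set (Fin 2 ⊕ Fin 2 → ℂ)}
    (h : MMCaseDimPiOneFree W ∧ ¬ UnprojectedDense W) :
    MMCaseDimPiOneFree (indexSwapped W) ∧ ¬ UnprojectedDense (indexSwapped W) :=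
  ⟨mmCaseDimPiOneFree_indexSwapped h.1, fun h' => h.2 ((unprojectedDense_indexSwapped_iff W).1 h')⟩

end IndexSwap

/-! ## Part 5 — applications: graphs over `x₁` -/

section Applications

/-- The swapped graph surface `{x₀ = p(x₁), y₁ = q(y₀)} = (S_{p,q})^σ`. [folklore] -/
theorem mem_indexSwapped_graphPolySurface_iff (p q : Polynomial ℂ) (z : Fin 2 ⊕ Fin 2 → ℂ) :
    z ∈ indexSwapped (graphPolySurface p q) ↔
      z (Sum.inl 0) = p.eval (z (Sum.inl 1)) ∧ z (Sum.inr 1) = q.eval (z (Sum.inr 0)) := by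
  rw [mem_indexSwapped_iff, mem_graphPolySurface_iff]
  simp

/-- The case certificate for `{x₀ = p(x₁), y₁ = c}`, `deg p ≥ 2`, `c ≠ 0`. [folklore] -/
theorem mmCase_indexSwapped_graphPolySurface_C {p : Polynomial ℂ} (hd : 2 ≤ p.natDegree) {c : ℂ}
    (hc : c ≠ 0) : MMCaseDimPiOneFree (indexSwapped (graphPolySurface p (Polynomial.C c))) :=
  mmCaseDimPiOneFree_indexSwapped (mmCase_graphPolySurface_C hd hc)

/-- **The swapped crossed family** `{x₀ = p(x₁), y₁ = q(y₀)}` (`deg p ≥ 2`, `q` non-constant) is in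
case (dim-pi-S-1-free) and has Zariski dense exponential points (transfer of
`unprojectedDensityQuestion_instance_crossed`). [folklore] -/
theorem densityInstance_indexSwapped_crossed {p q : Polynomial ℂ} (hd : 2 ≤ p.natDegree)
    (hq : 0 < q.natDegree) :
    MMCaseDimPiOneFree (indexSwapped (graphPolySurface p q)) ∧
      UnprojectedDense (indexSwapped (graphPolySurface p q)) :=
  densityInstance_indexSwapped (unprojectedDensityQuestion_instance_crossed hd hq)

/-- **The swapped resonant parabola** `{x₀ = x₁²/(2πi), y₁ = 1}` is in case (dim-pi-S-1-free) and its
exponential points are NOT Zariski dense. [folklore] -/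
theorem densityCounterexample_indexSwapped_resonantParabola :
    MMCaseDimPiOneFree (indexSwapped resonantParabola) ∧
      ¬ UnprojectedDense (indexSwapped resonantParabola) :=
  densityCounterexample_indexSwapped ⟨mmCase_resonantParabola, not_unprojectedDense_resonantParabola⟩

end Applications


/-! ## Part 6 — polynomial coordinate changes in general

A bijection `φ` of `K^ι` realised on polynomials by a `K`-algebra automorphism `E` of `K[X_ι]`
(`f(φ z) = (E f)(z)`, and `f(ψ z) = (E⁻¹ f)(z)` for the inverse `ψ`) moves vanishing ideals, zero
loci, closures, closedness, irreducibility and dimension.  (`linSubst` of `EACMonomialChange`,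
`rename idxSwap` above and the translations below are instances.) [folklore] -/

section Subst

variable {K : Type*} [Field K] {ι : Type*}

/-- `I(φ S) = E⁻¹(I(S))` (as a comap along `E`). [folklore] -/
theorem vanishingIdeal_image_of_subst {φ : (ι → K) → (ι → K)}
    {e : MvPolynomial ι K →ₐ[K] MvPolynomial ι K} (he : ∀ z f, aeval z (e f) = aeval (φ z) f)
    (S : Set (ι → K)) : vanishingIdeal K (φ '' S) = (vanishingIdeal K S).comap e := by
  ext f
  simp only [mem_vanishingIdeal_iff, Ideal.mem_comap, Set.forall_mem_image, he]

/-- `φ(Z(I)) = Z(E⁻¹ I)` for an invertible coordinate change. [folklore] -/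
theorem image_zeroLocus_of_subst {φ ψ : (ι → K) → (ι → K)}
    {e' : MvPolynomial ι K →ₐ[K] MvPolynomial ι K} (he' : ∀ z f, aeval z (e' f) = aeval (ψ z) f)
    (hφψ : ∀ y, φ (ψ y) = y) (hψφ : ∀ x, ψ (φ x) = x) (I : Ideal (MvPolynomial ι K)) :
    φ '' zeroLocus K I = zeroLocus K (I.map e') := by
  ext y
  rw [Ideal.map, zeroLocus_span, Set.mem_setOf_eq, Set.mem_image]
  constructor
  · rintro ⟨x, hx, rfl⟩ p ⟨q, hq, rfl⟩
    rw [he', hψφ]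
    exact (mem_zeroLocus_iff.1 hx) q hq
  · intro hy
    refine ⟨ψ y, ?_, hφψ y⟩
    rw [mem_zeroLocus_iff]
    intro q hq
    have h := hy (e' q) ⟨q, hq, rfl⟩
    rwa [he'] at h

/-- Closedness transports. [folklore] -/
theorem isZariskiClosed_image_of_subst {φ ψ : (ι → K) → (ι → K)}
    {e' : MvPolynomial ι K →ₐ[K] MvPolynomial ι K} (he' : ∀ z f, aeval z (e' f) = aeval (ψ z) f)
    (hφψ : ∀ y, φ (ψ y) = y) (hψφ : ∀ x, ψ (φ x) = x) {S : Set (ι → K)}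
    (hS : IsZariskiClosed K S) : IsZariskiClosed K (φ '' S) := by
  obtain ⟨I, rfl⟩ := hS
  exact ⟨I.map e', image_zeroLocus_of_subst he' hφψ hψφ I⟩

/-- Irreducibility transports. [folklore] -/
theorem isIrreducibleClosed_image_of_subst {φ ψ : (ι → K) → (ι → K)}
    {e e' : MvPolynomial ι K →ₐ[K] MvPolynomial ι K} (he : ∀ z f, aeval z (e f) = aeval (φ z) f)
    (he' : ∀ z f, aeval z (e' f) = aeval (ψ z) f) (hφψ : ∀ y, φ (ψ y) = y)
    (hψφ : ∀ x, ψ (φ x) = x) {S : Set (ι → K)} (hS : IsIrreducibleClosed K S) :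
    IsIrreducibleClosed K (φ '' S) := by
  refine ⟨isZariskiClosed_image_of_subst he' hφψ hψφ hS.1, ?_⟩
  rw [vanishingIdeal_image_of_subst he]
  haveI := hS.2
  exact Ideal.comap_isPrime e _

/-- **Zariski closure commutes with the coordinate change**: `cl(φ S) = φ(cl S)`. [folklore] -/
theorem zeroLocus_vanishingIdeal_image_of_subst {φ ψ : (ι → K) → (ι → K)}
    {e e' : MvPolynomial ι K →ₐ[K] MvPolynomial ι K} (he : ∀ z f, aeval z (e f) = aeval (φ z) f)
    (he' : ∀ z f, aeval z (e' f) = aeval (ψ z) f) (hφψ : ∀ y, φ (ψ y) = y)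
    (hψφ : ∀ x, ψ (φ x) = x) (S : Set (ι → K)) :
    zeroLocus K (vanishingIdeal K (φ '' S)) = φ '' zeroLocus K (vanishingIdeal K S) := by
  ext y
  constructor
  · intro hy
    refine ⟨ψ y, ?_, hφψ y⟩
    rw [mem_zeroLocus_iff]
    intro q hq
    have hq' : e' q ∈ vanishingIdeal K (φ '' S) := by
      rw [mem_vanishingIdeal_iff]
      rintro _ ⟨x, hx, rfl⟩
      rw [he', hψφ]
      exact (mem_vanishingIdeal_iff.1 hq) x hx
    have h := (mem_zeroLocus_iff.1 hy) _ hq'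
    rwa [he'] at h
  · rintro ⟨x, hx, rfl⟩
    rw [mem_zeroLocus_iff]
    intro f hf
    have hf' : e f ∈ vanishingIdeal K S := by
      rw [mem_vanishingIdeal_iff]
      intro x' hx'
      rw [he]
      exact (mem_vanishingIdeal_iff.1 hf) _ ⟨x', hx', rfl⟩
    have h := (mem_zeroLocus_iff.1 hx) _ hf'
    rwa [he] at h

/-- **Dimension is invariant** when `φ` is realised by an algebra automorphism `E`: the
coordinate rings `K[X]/I(S)` and `K[X]/I(φ S)` are isomorphic. [folklore] -/
theorem zariskiDim_image_of_subst {φ : (ι → K) → (ι → K)}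
    (E : MvPolynomial ι K ≃ₐ[K] MvPolynomial ι K) (hE : ∀ z f, aeval z (E f) = aeval (φ z) f)
    (S : Set (ι → K)) : zariskiDim K (φ '' S) = zariskiDim K S := by
  let g : MvPolynomial ι K ≃+* MvPolynomial ι K := E.symm.toRingEquiv
  set I := vanishingIdeal K S with hI
  have hcomap : vanishingIdeal K (φ '' S) = I.comap (E : MvPolynomial ι K →ₐ[K] MvPolynomial ι K) :=
    vanishingIdeal_image_of_subst (e := (E : MvPolynomial ι K →ₐ[K] MvPolynomial ι K))
      (fun z f => hE z f) S
  have hmap : I.map (g : MvPolynomial ι K →+* MvPolynomial ι K) = vanishingIdeal K (φ '' S) := by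
    rw [hcomap, Ideal.map_comap_of_equiv]
    ext p
    simp only [Ideal.mem_comap]
    exact Iff.rfl
  have e : (MvPolynomial ι K ⧸ I) ≃+* (MvPolynomial ι K ⧸ vanishingIdeal K (φ '' S)) :=
    Ideal.quotientEquiv I _ g hmap.symm
  unfold zariskiDim
  exact (ringKrullDim_eq_of_ringEquiv e).symm

/-- **Density of the exponential points transports** along any coordinate change realised on
polynomials and mapping `Γ_exp` into itself. [folklore] -/
theorem unprojectedDense_image_of_subst {n : ℕ}
    {φ : (Fin n ⊕ Fin n → ℂ) → (Fin n ⊕ Fin n → ℂ)}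
    {e : MvPolynomial (Fin n ⊕ Fin n) ℂ →ₐ[ℂ] MvPolynomial (Fin n ⊕ Fin n) ℂ}
    (he : ∀ z f, aeval z (e f) = aeval (φ z) f) (hΓ : ∀ z ∈ expGraph ℂ n, φ z ∈ expGraph ℂ n)
    {W : Set (Fin n ⊕ Fin n → ℂ)} (hW : UnprojectedDense W) : UnprojectedDense (φ '' W) := by
  have hW' : vanishingIdeal ℂ (W ∩ expGraph ℂ n) = vanishingIdeal ℂ W := hW
  unfold UnprojectedDense
  refine le_antisymm (fun f hf => ?_) (vanishingIdeal_anti_mono Set.inter_subset_left)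
  have hef : e f ∈ vanishingIdeal ℂ W := by
    rw [← hW', mem_vanishingIdeal_iff]
    rintro w ⟨hwW, hwΓ⟩
    rw [he]
    exact (mem_vanishingIdeal_iff.1 hf) _ ⟨⟨w, hwW, rfl⟩, hΓ w hwΓ⟩
  rw [mem_vanishingIdeal_iff]
  rintro _ ⟨x, hx, rfl⟩
  rw [← he]
  exact (mem_vanishingIdeal_iff.1 hef) x hx

end Subst

/-! ## Part 7 — translations `(x, y) ↦ (x + b, e^{b} · y)` -/

section Translation

variable {K : Type*} [Field K] {ι : Type*} {n : ℕ}

/-- Additive translation `x ↦ x + b` of `K^ι`, realised by `Xᵢ ↦ Xᵢ + bᵢ`. [folklore] -/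
def addTranslSubst (b : ι → K) : MvPolynomial ι K →ₐ[K] MvPolynomial ι K :=
  aeval fun i => X i + C (b i)

/-- Evaluation rule: `(addTranslSubst b f)(x) = f(x + b)`. [folklore] -/
theorem aeval_addTranslSubst (b : ι → K) (x : ι → K) (f : MvPolynomial ι K) :
    aeval x (addTranslSubst b f) = aeval (x + b) f := by
  have h1 : (aeval x).comp (addTranslSubst b) = aeval (x + b) := by
    refine algHom_ext fun i => ?_
    rw [AlgHom.comp_apply, addTranslSubst, aeval_X, aeval_X]
    simp
  exact DFunLike.congr_fun h1 f

/-- `addTranslSubst b ∘ addTranslSubst (-b) = id`. [folklore] -/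
theorem addTranslSubst_comp_neg (b : ι → K) :
    (addTranslSubst b).comp (addTranslSubst (-b)) = AlgHom.id K _ := by
  refine algHom_ext fun i => ?_
  rw [AlgHom.comp_apply, AlgHom.id_apply, addTranslSubst, addTranslSubst, aeval_X, map_add, aeval_X,
    aeval_C, MvPolynomial.algebraMap_eq, Pi.neg_apply, C_neg]
  ring

/-- The additive translation as an algebra automorphism. [folklore] -/
def addTranslEquiv (b : ι → K) : MvPolynomial ι K ≃ₐ[K] MvPolynomial ι K :=
  AlgEquiv.ofAlgHom (addTranslSubst b) (addTranslSubst (-b)) (addTranslSubst_comp_neg b)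
    (by simpa using addTranslSubst_comp_neg (-b))

/-- **Closure of a translate is the translate of the closure.** [folklore] -/
theorem zeroLocus_vanishingIdeal_image_add (b : ι → K) (B : Set (ι → K)) :
    zeroLocus K (vanishingIdeal K ((· + b) '' B)) = (· + b) '' zeroLocus K (vanishingIdeal K B) :=
  zeroLocus_vanishingIdeal_image_of_subst (φ := (· + b)) (ψ := (· + -b))
    (e := addTranslSubst b) (e' := addTranslSubst (-b)) (aeval_addTranslSubst b)
    (aeval_addTranslSubst (-b)) (fun y => by simp) (fun x => by simp) B

/-- Dimension of a translate. [folklore] -/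
theorem zariskiDim_image_add (b : ι → K) (B : Set (ι → K)) :
    zariskiDim K ((· + b) '' B) = zariskiDim K B :=
  zariskiDim_image_of_subst (φ := (· + b)) (addTranslEquiv b) (aeval_addTranslSubst b) B

/-- **A translate of a line of rational slope is one; pulled back**: if `L + b` is the line
`m · x = c` then `L` is the line `m · x = c - m · b`. [folklore] -/
theorem isRationalSlopeLine_of_image_add (b : Fin 2 → K) {L : Set (Fin 2 → K)}
    (h : IsRationalSlopeLine ((· + b) '' L)) : IsRationalSlopeLine L := by
  obtain ⟨m, hm, c, hc⟩ := h
  refine ⟨m, hm, c - ((m 0 : K) * b 0 + (m 1 : K) * b 1), ?_⟩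
  ext x
  simp only [Set.mem_setOf_eq]
  have key : x ∈ L ↔ x + b ∈ (· + b) '' L := by
    constructor
    · exact fun hx => ⟨x, hx, rfl⟩
    · rintro ⟨x', hx', he⟩
      have : x' = x := add_right_cancel he
      exact this ▸ hx'
  rw [key, hc, Set.mem_setOf_eq, Pi.add_apply, Pi.add_apply]
  constructor <;> intro h' <;> linear_combination h'

/-- **The translation–scaling** `(x, y) ↦ (x + b, t · y)` of `Kⁿ × Kⁿ`. [folklore] -/
def translScale (b t : Fin n → K) (z : Fin n ⊕ Fin n → K) : Fin n ⊕ Fin n → K :=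
  Sum.elim (fun i => z (Sum.inl i) + b i) (fun i => t i * z (Sum.inr i))

/-- Additive coordinates of `translScale`. [folklore] -/
@[simp] theorem translScale_inl (b t : Fin n → K) (z : Fin n ⊕ Fin n → K) (i : Fin n) :
    translScale b t z (Sum.inl i) = z (Sum.inl i) + b i := rfl

/-- Multiplicative coordinates of `translScale`. [folklore] -/
@[simp] theorem translScale_inr (b t : Fin n → K) (z : Fin n ⊕ Fin n → K) (i : Fin n) :
    translScale b t z (Sum.inr i) = t i * z (Sum.inr i) := rfl

/-- `π(translScale b t z) = π(z) + b`. [folklore] -/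
theorem projAdd_translScale (b t : Fin n → K) (z : Fin n ⊕ Fin n → K) :
    projAdd (translScale b t z) = projAdd z + b := by
  funext i
  simp [projAdd_apply]

/-- The inverse translation–scaling. [folklore] -/
theorem translScale_neg_inv_translScale (b t : Fin n → K) (ht : ∀ i, t i ≠ 0)
    (z : Fin n ⊕ Fin n → K) :
    translScale (-b) (fun i => (t i)⁻¹) (translScale b t z) = z := by
  funext k
  rcases k with i | i
  · simp
  · simp [ht i]

/-- … and the other composite. [folklore] -/
theorem translScale_translScale_neg_inv (b t : Fin n → K) (ht : ∀ i, t i ≠ 0)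
    (z : Fin n ⊕ Fin n → K) :
    translScale b t (translScale (-b) (fun i => (t i)⁻¹) z) = z := by
  funext k
  rcases k with i | i
  · simp
  · simp [ht i]

/-- The substitution `X_{xᵢ} ↦ X_{xᵢ} + bᵢ`, `X_{yᵢ} ↦ tᵢ X_{yᵢ}` realising `translScale b t`.
[folklore] -/
def translSubst (b t : Fin n → K) :
    MvPolynomial (Fin n ⊕ Fin n) K →ₐ[K] MvPolynomial (Fin n ⊕ Fin n) K :=
  aeval (Sum.elim (fun i => X (Sum.inl i) + C (b i)) (fun i => C (t i) * X (Sum.inr i)))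

/-- Evaluation rule: `(translSubst b t f)(z) = f(translScale b t z)`. [folklore] -/
theorem aeval_translSubst (b t : Fin n → K) (z : Fin n ⊕ Fin n → K)
    (f : MvPolynomial (Fin n ⊕ Fin n) K) :
    aeval z (translSubst b t f) = aeval (translScale b t z) f := by
  have h1 : (aeval z).comp (translSubst b t) = aeval (translScale b t z) := by
    refine algHom_ext fun k => ?_
    rw [AlgHom.comp_apply, translSubst, aeval_X, aeval_X]
    rcases k with i | i <;> simp
  exact DFunLike.congr_fun h1 f

/-- `translSubst b t ∘ translSubst (-b) t⁻¹ = id` (`tᵢ ≠ 0`). [folklore] -/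
theorem translSubst_comp_neg_inv (b t : Fin n → K) (ht : ∀ i, t i ≠ 0) :
    (translSubst b t).comp (translSubst (-b) fun i => (t i)⁻¹) = AlgHom.id K _ := by
  refine algHom_ext fun k => ?_
  rw [AlgHom.comp_apply, AlgHom.id_apply]
  rcases k with i | i
  · rw [translSubst, translSubst, aeval_X, Sum.elim_inl, map_add, aeval_X, Sum.elim_inl, aeval_C,
      MvPolynomial.algebraMap_eq, Pi.neg_apply, C_neg]
    ring
  · rw [translSubst, translSubst, aeval_X, Sum.elim_inr, map_mul, aeval_X, Sum.elim_inr, aeval_C,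
      MvPolynomial.algebraMap_eq, ← mul_assoc, ← C_mul, inv_mul_cancel₀ (ht i), C_1, one_mul]

/-- `translSubst (-b) t⁻¹ ∘ translSubst b t = id` (`tᵢ ≠ 0`). [folklore] -/
theorem translSubst_neg_inv_comp (b t : Fin n → K) (ht : ∀ i, t i ≠ 0) :
    (translSubst (-b) fun i => (t i)⁻¹).comp (translSubst b t) = AlgHom.id K _ := by
  refine algHom_ext fun k => ?_
  rw [AlgHom.comp_apply, AlgHom.id_apply]
  rcases k with i | i
  · rw [translSubst, translSubst, aeval_X, Sum.elim_inl, map_add, aeval_X, Sum.elim_inl, aeval_C,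
      MvPolynomial.algebraMap_eq, Pi.neg_apply, C_neg]
    ring
  · rw [translSubst, translSubst, aeval_X, Sum.elim_inr, map_mul, aeval_X, Sum.elim_inr, aeval_C,
      MvPolynomial.algebraMap_eq, ← mul_assoc, ← C_mul, mul_inv_cancel₀ (ht i), C_1, one_mul]

/-- The translation–scaling as an algebra automorphism of `K[X, Y]`. [folklore] -/
def translSubstEquiv (b t : Fin n → K) (ht : ∀ i, t i ≠ 0) :
    MvPolynomial (Fin n ⊕ Fin n) K ≃ₐ[K] MvPolynomial (Fin n ⊕ Fin n) K :=
  AlgEquiv.ofAlgHom (translSubst b t) (translSubst (-b) fun i => (t i)⁻¹)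
    (translSubst_comp_neg_inv b t ht) (translSubst_neg_inv_comp b t ht)

/-- **The exponential translation** `τ_b (x, y) = (x + b, e^{b} · y)` of `ℂⁿ × ℂⁿ`. [folklore] -/
def expTransl (b : Fin n → ℂ) : (Fin n ⊕ Fin n → ℂ) → (Fin n ⊕ Fin n → ℂ) :=
  translScale b fun i => Complex.exp (b i)

/-- `τ_{-b} ∘ τ_b = id`. [folklore] -/
theorem expTransl_neg_expTransl (b : Fin n → ℂ) (z : Fin n ⊕ Fin n → ℂ) :
    expTransl (-b) (expTransl b z) = z := by
  funext k
  rcases k with i | i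
  · simp [expTransl]
  · simp only [expTransl, translScale_inr, Pi.neg_apply, Complex.exp_neg]
    rw [← mul_assoc, inv_mul_cancel₀ (Complex.exp_ne_zero _), one_mul]

/-- `τ_b ∘ τ_{-b} = id`. [folklore] -/
theorem expTransl_expTransl_neg (b : Fin n → ℂ) (z : Fin n ⊕ Fin n → ℂ) :
    expTransl b (expTransl (-b) z) = z := by
  simpa using expTransl_neg_expTransl (-b) z

/-- `τ_{-b}` is the inverse translation–scaling `translScale (-b) (e^{b})⁻¹`. [folklore] -/
theorem translScale_neg_inv_eq_expTransl_neg (b : Fin n → ℂ) (z : Fin n ⊕ Fin n → ℂ) :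
    translScale (-b) (fun i => (Complex.exp (b i))⁻¹) z = expTransl (-b) z := by
  simp only [expTransl, Pi.neg_apply, Complex.exp_neg]

/-- Evaluation rules for `τ_b` and `τ_{-b}` through `translSubst` and the automorphism
`translSubstEquiv`. [folklore] -/
theorem aeval_translSubst_exp (b : Fin n → ℂ) (z : Fin n ⊕ Fin n → ℂ)
    (f : MvPolynomial (Fin n ⊕ Fin n) ℂ) :
    aeval z (translSubst b (fun i => Complex.exp (b i)) f) = aeval (expTransl b z) f :=
  aeval_translSubst b _ z f

/-- Evaluation rule for the inverse substitution: `τ_{-b}`. [folklore] -/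
theorem aeval_translSubst_exp_inv (b : Fin n → ℂ) (z : Fin n ⊕ Fin n → ℂ)
    (f : MvPolynomial (Fin n ⊕ Fin n) ℂ) :
    aeval z (translSubst (-b) (fun i => (Complex.exp (b i))⁻¹) f) = aeval (expTransl (-b) z) f := by
  rw [← translScale_neg_inv_eq_expTransl_neg]
  exact aeval_translSubst (-b) _ z f

/-- Evaluation rule through the automorphism `translSubstEquiv`. [folklore] -/
theorem aeval_translSubstEquiv_exp (b : Fin n → ℂ) (z : Fin n ⊕ Fin n → ℂ)
    (f : MvPolynomial (Fin n ⊕ Fin n) ℂ) :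
    aeval z (translSubstEquiv b (fun i => Complex.exp (b i)) (fun _ => Complex.exp_ne_zero _) f) =
      aeval (expTransl b z) f :=
  aeval_translSubst b _ z f

/-- `τ_b` preserves the torus locus (both ways). [folklore] -/
theorem expTransl_mem_torusLocus_iff (b : Fin n → ℂ) (z : Fin n ⊕ Fin n → ℂ) :
    expTransl b z ∈ torusLocus ℂ n ↔ z ∈ torusLocus ℂ n := by
  simp [mem_torusLocus_iff, expTransl, Complex.exp_ne_zero]

/-- `τ_b` maps the graph of `exp` to itself: `e^{b} e^{x} = e^{x + b}`. [folklore] -/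
theorem expTransl_mem_expGraph {b : Fin n → ℂ} {z : Fin n ⊕ Fin n → ℂ} (hz : z ∈ expGraph ℂ n) :
    expTransl b z ∈ expGraph ℂ n := by
  rw [mem_expGraph_iff] at hz ⊢
  intro i
  rw [expTransl, translScale_inr, translScale_inl, hz i, ExponentialRing.complex_exp_eq,
    Complex.exp_add, mul_comm]

/-- The image of the torus part is the torus part of the image. [folklore] -/
theorem image_expTransl_inter_torusLocus (b : Fin n → ℂ) (W : Set (Fin n ⊕ Fin n → ℂ)) :
    expTransl b '' W ∩ torusLocus ℂ n = expTransl b '' (W ∩ torusLocus ℂ n) := by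
  ext z
  constructor
  · rintro ⟨⟨w, hw, rfl⟩, hT⟩
    exact ⟨w, ⟨hw, (expTransl_mem_torusLocus_iff b w).1 hT⟩, rfl⟩
  · rintro ⟨w, ⟨hw, hT⟩, rfl⟩
    exact ⟨⟨w, hw, rfl⟩, (expTransl_mem_torusLocus_iff b w).2 hT⟩

/-- The base of the translate is the translate of the base: `π(τ_b W ∩ Gⁿ) = π(W ∩ Gⁿ) + b`.
[folklore] -/
theorem projAdd_image_expTransl_inter (b : Fin n → ℂ) (W : Set (Fin n ⊕ Fin n → ℂ)) :
    projAdd '' (expTransl b '' W ∩ torusLocus ℂ n) = (· + b) '' (projAdd '' (W ∩ torusLocus ℂ n)) := by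
  rw [image_expTransl_inter_torusLocus, Set.image_image, Set.image_image]
  refine Set.image_congr' fun z => ?_
  exact projAdd_translScale b _ z

/-- **`τ_b W` is irreducible closed of the same dimension** when `W` is. [folklore] -/
theorem isIrreducibleClosed_image_expTransl (b : Fin n → ℂ) {W : Set (Fin n ⊕ Fin n → ℂ)}
    (hW : IsIrreducibleClosed ℂ W) : IsIrreducibleClosed ℂ (expTransl b '' W) :=
  isIrreducibleClosed_image_of_subst (aeval_translSubst_exp b) (aeval_translSubst_exp_inv b)
    (expTransl_expTransl_neg b) (expTransl_neg_expTransl b) hW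

/-- Dimension is translation-invariant. [folklore] -/
theorem zariskiDim_image_expTransl (b : Fin n → ℂ) (W : Set (Fin n ⊕ Fin n → ℂ)) :
    zariskiDim ℂ (expTransl b '' W) = zariskiDim ℂ W :=
  zariskiDim_image_of_subst _ (aeval_translSubstEquiv_exp b) W

/-- `addProjDim` is translation-invariant. [folklore] -/
theorem addProjDim_image_expTransl (b : Fin n → ℂ) (W : Set (Fin n ⊕ Fin n → ℂ)) :
    addProjDim ℂ n (expTransl b '' W) = addProjDim ℂ n W := by
  unfold addProjDim
  rw [projAdd_image_expTransl_inter, zariskiDim_image_add]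

/-- **`UnprojectedDense` is translation-invariant.** [folklore] -/
theorem unprojectedDense_image_expTransl_iff (b : Fin n → ℂ) (W : Set (Fin n ⊕ Fin n → ℂ)) :
    UnprojectedDense (expTransl b '' W) ↔ UnprojectedDense W := by
  refine ⟨fun h => ?_, unprojectedDense_image_of_subst (aeval_translSubst_exp b)
    (fun z hz => expTransl_mem_expGraph hz)⟩
  have h' := unprojectedDense_image_of_subst (aeval_translSubst_exp (-b))
    (fun z hz => expTransl_mem_expGraph hz) h
  have e : expTransl (-b) '' (expTransl b '' W) = W := by
    rw [Set.image_image]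
    simp [expTransl_neg_expTransl]
  rwa [e] at h'

/-- Multiplicative freeness of the torus part is translation-invariant (a character is multiplied
by the nonzero constant `e^{m · b}`). [folklore] -/
theorem isMulFree_image_expTransl_inter (b : Fin n → ℂ) {W : Set (Fin n ⊕ Fin n → ℂ)}
    (hmul : IsMulFree ℂ n (W ∩ torusLocus ℂ n)) :
    IsMulFree ℂ n (expTransl b '' W ∩ torusLocus ℂ n) := by
  intro m hm ⟨c, hc⟩
  refine hmul m hm ⟨c * (∏ j, Complex.exp (b j) ^ m j)⁻¹, fun z hz => ?_⟩
  have hz' : expTransl b z ∈ expTransl b '' W ∩ torusLocus ℂ n :=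
    ⟨⟨z, hz.1, rfl⟩, (expTransl_mem_torusLocus_iff b z).2 hz.2⟩
  have h := hc (expTransl b z) hz'
  simp only [expTransl, translScale_inr, mul_zpow, Finset.prod_mul_distrib] at h
  rw [← h, mul_comm ((∏ j, Complex.exp (b j) ^ m j)) _, mul_assoc, mul_inv_cancel₀, mul_one]
  exact Finset.prod_ne_zero_iff.2 fun j _ => zpow_ne_zero _ (Complex.exp_ne_zero _)

/-- **Case (dim-pi-S-1-free) is translation-invariant.** [folklore] -/
theorem mmCaseDimPiOneFree_image_expTransl (b : Fin 2 → ℂ) {W : Set (Fin 2 ⊕ Fin 2 → ℂ)}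
    (h : MMCaseDimPiOneFree W) : MMCaseDimPiOneFree (expTransl b '' W) := by
  obtain ⟨hW, hne, hdim, hapd, hline⟩ := h
  refine ⟨isIrreducibleClosed_image_expTransl b hW, ?_, (zariskiDim_image_expTransl b W).trans hdim,
    (addProjDim_image_expTransl b W).trans hapd, ?_⟩
  · obtain ⟨z, hz, hT⟩ := hne
    exact ⟨expTransl b z, ⟨z, hz, rfl⟩, (expTransl_mem_torusLocus_iff b z).2 hT⟩
  · rw [projAdd_image_expTransl_inter, zeroLocus_vanishingIdeal_image_add]
    exact fun h' => hline (isRationalSlopeLine_of_image_add b h')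

/-- Positive, negative and free instances translate. [folklore] -/
theorem densityInstance_image_expTransl (b : Fin 2 → ℂ) {W : Set (Fin 2 ⊕ Fin 2 → ℂ)}
    (h : MMCaseDimPiOneFree W ∧ UnprojectedDense W) :
    MMCaseDimPiOneFree (expTransl b '' W) ∧ UnprojectedDense (expTransl b '' W) :=
  ⟨mmCaseDimPiOneFree_image_expTransl b h.1, (unprojectedDense_image_expTransl_iff b W).2 h.2⟩

/-- Negative instances translate. [folklore] -/
theorem densityCounterexample_image_expTransl (b : Fin 2 → ℂ) {W : Set (Fin 2 ⊕ Fin 2 → ℂ)}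
    (h : MMCaseDimPiOneFree W ∧ ¬ UnprojectedDense W) :
    MMCaseDimPiOneFree (expTransl b '' W) ∧ ¬ UnprojectedDense (expTransl b '' W) :=
  ⟨mmCaseDimPiOneFree_image_expTransl b h.1,
    fun h' => h.2 ((unprojectedDense_image_expTransl_iff b W).1 h')⟩

/-- Example of the dictionary: translating `{x₁ = p(x₀), y₀ = c}` by `b = (β, 0)` gives
`{x₁ = p(x₀ - β), y₀ = e^{β} c}` — constant fibres with ANY `c ≠ 0` are translates of constant
fibres with `c = 1` (membership computed; consistent with the phase criterion of
`EACDensityPhases`, whose phase polynomial `p(z₀ + 2πi t)` is visibly translation-covariant).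
[folklore] -/
theorem mem_image_expTransl_graphPolySurface_C_iff (p : Polynomial ℂ) (c β : ℂ)
    (z : Fin 2 ⊕ Fin 2 → ℂ) :
    z ∈ expTransl ![β, 0] '' graphPolySurface p (Polynomial.C c) ↔
      z (Sum.inl 1) = p.eval (z (Sum.inl 0) - β) ∧ z (Sum.inr 0) = Complex.exp β * c := by
  constructor
  · rintro ⟨w, hw, rfl⟩
    rw [mem_graphPolySurface_iff, Polynomial.eval_C] at hw
    simp only [expTransl, translScale_inl, translScale_inr, Matrix.cons_val_one,
      Matrix.cons_val_zero, add_zero, add_sub_cancel_right]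
    exact ⟨hw.1, by rw [hw.2]⟩
  · rintro ⟨h1, h0⟩
    refine ⟨expTransl (-![β, 0]) z, ?_, expTransl_expTransl_neg _ z⟩
    rw [mem_graphPolySurface_iff, Polynomial.eval_C]
    simp only [expTransl, translScale_inl, translScale_inr, Pi.neg_apply, Matrix.cons_val_one,
      Matrix.cons_val_zero, neg_zero, add_zero, Complex.exp_neg]
    refine ⟨by rw [h1, sub_eq_add_neg], ?_⟩
    rw [h0, ← mul_assoc, inv_mul_cancel₀ (Complex.exp_ne_zero _), one_mul]

end Translation


/-! ## Part 8 — explicit targets: recognising `W^U` and `τ_b W`, the shear and a translate -/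

section Targets

variable {K : Type*} [Field K] {n : ℕ}

/-- **Recognition lemma**: if the torus part of an irreducible closed `W'` meeting the torus is
exactly `Φ_U(W ∩ Gⁿ)`, then `W^U = W'`. [folklore] -/
theorem latticeClosure_eq_of_latticeImage_eq (U : Matrix (Fin n) (Fin n) ℤ)
    {W W' : Set (Fin n ⊕ Fin n → K)} (hW' : IsIrreducibleClosed K W')
    (hne' : (W' ∩ torusLocus K n).Nonempty) (h : latticeImage U W = W' ∩ torusLocus K n) :
    latticeClosure U W = W' := by
  unfold latticeClosure
  rw [h, vanishingIdeal_inter_torusLocus_of_irred hW' hne']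
  exact zeroLocus_vanishingIdeal_of_isZariskiClosed hW'.1

/-- The additive **shear** `(1 0; m 1) ∈ SL₂(ℤ)`: `Φ(x₀, x₁, y₀, y₁) = (x₀, m x₀ + x₁, y₀, y₀^m y₁)`.
[folklore] -/
def shearMat (m : ℤ) : Matrix (Fin 2) (Fin 2) ℤ := !![1, 0; m, 1]

/-- `(1 0; m 1)(1 0; -m 1) = 1`. [folklore] -/
theorem shearMat_mul_shearMat_neg (m : ℤ) : shearMat m * shearMat (-m) = 1 := by
  simp [shearMat, Matrix.one_fin_two]

/-- `(1 0; -m 1)(1 0; m 1) = 1`. [folklore] -/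
theorem shearMat_neg_mul_shearMat (m : ℤ) : shearMat (-m) * shearMat m = 1 := by
  simpa using shearMat_mul_shearMat_neg (-m)

/-- The shear on points of the torus locus, coordinatewise. [folklore] -/
theorem latticeChange_shearMat (m : ℤ) (z : Fin 2 ⊕ Fin 2 → K) :
    latticeChange (shearMat m) z =
      Sum.elim ![z (Sum.inl 0), (m : K) * z (Sum.inl 0) + z (Sum.inl 1)]
        ![z (Sum.inr 0), z (Sum.inr 0) ^ m * z (Sum.inr 1)] := by
  funext k
  rcases k with i | i
  · rw [latticeChange_inl]
    fin_cases i <;> simp [intLinMap, shearMat, Fin.sum_univ_two, projAdd_apply]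
  · rw [latticeChange_inr]
    fin_cases i <;> simp [monomialMap, shearMat, Fin.prod_univ_two, projMul_apply]

/-- **The shear of a constant-fibre graph surface**:
`Φ_{(1 0; m 1)}({x₁ = p(x₀), y₀ = c} ∩ G²) = {x₁ = p(x₀) + m x₀, y₀ = c} ∩ G²`. [folklore] -/
theorem latticeImage_shearMat_graphPolySurface_C (m : ℤ) (p : Polynomial ℂ) (c : ℂ) :
    latticeImage (shearMat m) (graphPolySurface p (Polynomial.C c)) =
      graphPolySurface (p + Polynomial.C (m : ℂ) * Polynomial.X) (Polynomial.C c) ∩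
        torusLocus ℂ 2 := by
  ext z
  simp only [latticeImage, Set.mem_image, Set.mem_inter_iff, mem_graphPolySurface_iff,
    Polynomial.eval_C, Polynomial.eval_add, Polynomial.eval_mul, Polynomial.eval_X,
    mem_torusLocus_iff]
  constructor
  · rintro ⟨w, ⟨⟨hw1, hw0⟩, hwT⟩, rfl⟩
    rw [latticeChange_shearMat]
    simp only [Sum.elim_inl, Sum.elim_inr, Matrix.cons_val_zero, Matrix.cons_val_one,
      Matrix.cons_val_fin_one]
    refine ⟨⟨by rw [hw1]; ring, hw0⟩, fun i => ?_⟩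
    fin_cases i
    · simpa using hwT 0
    · simpa using mul_ne_zero (zpow_ne_zero m (hwT 0)) (hwT 1)
  · rintro ⟨⟨h1, h0⟩, hT⟩
    have hT0 : z (Sum.inr 0) ≠ 0 := hT 0
    have hT1 : z (Sum.inr 1) ≠ 0 := hT 1
    refine ⟨Sum.elim ![z (Sum.inl 0), z (Sum.inl 1) - (m : ℂ) * z (Sum.inl 0)]
      ![z (Sum.inr 0), (z (Sum.inr 0) ^ m)⁻¹ * z (Sum.inr 1)], ⟨⟨?_, ?_⟩, fun i => ?_⟩, ?_⟩
    · simp only [Sum.elim_inl, Matrix.cons_val_one, Matrix.cons_val_fin_one, Matrix.cons_val_zero]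
      rw [h1]; ring
    · simpa using h0
    · fin_cases i
      · simpa using hT0
      · simpa using mul_ne_zero (inv_ne_zero (zpow_ne_zero m hT0)) hT1
    · rw [latticeChange_shearMat]
      funext k
      rcases k with i | i
      · fin_cases i
        · simp
        · simp only [Fin.mk_one, Fin.isValue, Sum.elim_inl, Matrix.cons_val_one,
            Matrix.cons_val_fin_one, Matrix.cons_val_zero]
          ring
      · fin_cases i
        · simp
        · simp only [Fin.mk_one, Fin.isValue, Sum.elim_inr, Matrix.cons_val_one,
            Matrix.cons_val_fin_one, Matrix.cons_val_zero]
          rw [← mul_assoc, mul_inv_cancel₀ (zpow_ne_zero m hT0), one_mul]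

/-- **`{x₁ = p(x₀), y₀ = c}^{(1 0; m 1)} = {x₁ = p(x₀) + m x₀, y₀ = c}`** (`c ≠ 0`): the shear adds an
INTEGER multiple of `x₀` to `p` — consistent with the phase criterion of `EACDensityPhases` (it adds
the integer `m k` to the phase polynomial `p(z₀ + 2πik)/(2πi)`, up to the constant `m z₀/(2πi)`).
[folklore] -/
theorem latticeClosure_shearMat_graphPolySurface_C (m : ℤ) (p : Polynomial ℂ) {c : ℂ} (hc : c ≠ 0) :
    latticeClosure (shearMat m) (graphPolySurface p (Polynomial.C c)) =
      graphPolySurface (p + Polynomial.C (m : ℂ) * Polynomial.X) (Polynomial.C c) :=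
  latticeClosure_eq_of_latticeImage_eq _ (isIrreducibleClosed_graphPolySurface _ _)
    (graphPolySurface_inter_torusLocus_nonempty _ (Polynomial.C_ne_zero.2 hc))
    (latticeImage_shearMat_graphPolySurface_C m p c)

/-- Hence density for `{x₁ = p(x₀) + m x₀, y₀ = c}` and for `{x₁ = p(x₀), y₀ = c}` are equivalent
(`c ≠ 0`, `m ∈ ℤ`) — by transport, independently of the phase criterion. [folklore] -/
theorem unprojectedDense_graphPolySurface_add_intMul_iff (m : ℤ) (p : Polynomial ℂ) {c : ℂ}
    (hc : c ≠ 0) :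
    UnprojectedDense (graphPolySurface (p + Polynomial.C (m : ℂ) * Polynomial.X) (Polynomial.C c)) ↔
      UnprojectedDense (graphPolySurface p (Polynomial.C c)) := by
  rw [← latticeClosure_shearMat_graphPolySurface_C m p hc]
  exact unprojectedDense_latticeClosure_iff (shearMat_mul_shearMat_neg m)
    (shearMat_neg_mul_shearMat m) (isIrreducibleClosed_graphPolySurface _ _)
    (graphPolySurface_inter_torusLocus_nonempty _ (Polynomial.C_ne_zero.2 hc))

/-- **The translate of a constant-fibre graph surface**:
`τ_{(β, 0)} {x₁ = p(x₀), y₀ = c} = {x₁ = p(x₀ - β), y₀ = e^{β} c}`. [folklore] -/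
theorem image_expTransl_graphPolySurface_C (p : Polynomial ℂ) (c β : ℂ) :
    expTransl ![β, 0] '' graphPolySurface p (Polynomial.C c) =
      graphPolySurface (p.comp (Polynomial.X - Polynomial.C β))
        (Polynomial.C (Complex.exp β * c)) := by
  ext z
  rw [mem_image_expTransl_graphPolySurface_C_iff, mem_graphPolySurface_iff, Polynomial.eval_comp,
    Polynomial.eval_sub, Polynomial.eval_X, Polynomial.eval_C, Polynomial.eval_C]

/-- Hence `{x₁ = p(x₀ - β), y₀ = e^{β} c}` is dense iff `{x₁ = p(x₀), y₀ = c}` is: every constant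
fibre value `c' ≠ 0` is reached from `c = 1` (`β = log c'`). [folklore] -/
theorem unprojectedDense_graphPolySurface_comp_sub_iff (p : Polynomial ℂ) (c β : ℂ) :
    UnprojectedDense (graphPolySurface (p.comp (Polynomial.X - Polynomial.C β))
        (Polynomial.C (Complex.exp β * c))) ↔
      UnprojectedDense (graphPolySurface p (Polynomial.C c)) := by
  rw [← image_expTransl_graphPolySurface_C]
  exact unprojectedDense_image_expTransl_iff _ _

end Targets


/-! ## Part 9 — lines as bases: admissible iff the slope is not rational -/

section Lines

/- `linePoly a b = C a * X + C b` and `eval_linePoly` are from `EACDensityFamilies` (where lines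
of NON-REAL slope were settled: `mmCase_lineSurface`, `unprojectedDense_lineSurface`); here the
slope may be real irrational. -/

/-- Integer relations `m₀ x + m₁ (a x + β) ≡ c` on a line of NON-RATIONAL slope `a ∉ ℚ` are trivial.
[folklore] -/
theorem lineCoeffs_eq_zero_of_not_rat {a β : ℂ} (ha : ∀ r : ℚ, a ≠ (r : ℂ)) (m₀ m₁ : ℤ) (c : ℂ)
    (h : ∀ x : ℂ, (m₀ : ℂ) * x + (m₁ : ℂ) * (linePoly a β).eval x = c) : m₀ = 0 ∧ m₁ = 0 := by
  simp only [eval_linePoly] at h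
  have h0 := h 0
  have h1 := h 1
  have hlin : (m₀ : ℂ) + (m₁ : ℂ) * a = 0 := by linear_combination h1 - h0
  by_cases hm₁ : m₁ = 0
  · subst hm₁
    simp only [Int.cast_zero, zero_mul, add_zero, Int.cast_eq_zero] at hlin
    exact ⟨hlin, rfl⟩
  · exfalso
    have hm₁' : (m₁ : ℂ) ≠ 0 := by exact_mod_cast hm₁
    apply ha (-(m₀ : ℚ) / m₁)
    push_cast
    field_simp
    linear_combination hlin

/-- **Lines of non-rational slope are admissible bases**: `{x₁ = a x₀ + β, y₀ = q(y₁)}` with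
`a ∉ ℚ`, `q ≠ 0` is in case (dim-pi-S-1-free) (complex `a`: real-irrational and non-real slopes
alike; `mmCase_lineSurface` of `EACDensityFamilies` had `Im a ≠ 0`). [folklore] -/
theorem mmCase_graphPolySurface_line {a β : ℂ} (ha : ∀ r : ℚ, a ≠ (r : ℂ)) {q : Polynomial ℂ}
    (hq : q ≠ 0) : MMCaseDimPiOneFree (graphPolySurface (linePoly a β) q) :=
  ⟨isIrreducibleClosed_graphPolySurface _ _, graphPolySurface_inter_torusLocus_nonempty _ hq,
    zariskiDim_graphPolySurface _ _, addProjDim_graphPolySurface _ hq,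
    not_isRationalSlopeLine_graphPolySurface _ hq (lineCoeffs_eq_zero_of_not_rat ha)⟩

/-- A graph surface meeting the torus has `q ≠ 0`. [folklore] -/
theorem ne_zero_of_graphPolySurface_inter_torusLocus_nonempty {p q : Polynomial ℂ}
    (hne : (graphPolySurface p q ∩ torusLocus ℂ 2).Nonempty) : q ≠ 0 := by
  rintro rfl
  obtain ⟨z, hz, hT⟩ := hne
  rw [mem_graphPolySurface_iff, Polynomial.eval_zero] at hz
  exact (mem_torusLocus_iff.1 hT) 0 hz.2

/-- **Lines of rational slope are not** (whatever the fibres): the closure of the base is the line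
`-num(r) x₀ + den(r) x₁ = den(r) β`. [folklore] -/
theorem not_mmCase_graphPolySurface_line_rat (r : ℚ) (β : ℂ) (q : Polynomial ℂ) :
    ¬ MMCaseDimPiOneFree (graphPolySurface (linePoly r β) q) := by
  rintro ⟨-, hne, -, -, hline⟩
  have hq : q ≠ 0 := ne_zero_of_graphPolySurface_inter_torusLocus_nonempty hne
  apply hline
  have hden : (r.den : ℂ) ≠ 0 := Nat.cast_ne_zero.2 r.den_nz
  refine ⟨![-r.num, (r.den : ℤ)], ?_, (r.den : ℂ) * β, ?_⟩
  · intro h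
    have h1 := congr_fun h 1
    simp only [Matrix.cons_val_one, Matrix.cons_val_fin_one, Pi.zero_apply, Nat.cast_eq_zero] at h1
    exact r.den_nz h1
  · rw [projAdd_image_graphPolySurface_inter_torusLocus _ hq,
      zeroLocus_vanishingIdeal_of_isZariskiClosed (isZariskiClosed_graphBase _)]
    ext x
    simp only [graphBase, Set.mem_setOf_eq, eval_polynomial_aeval_X, Fin.castSucc_zero,
      Matrix.cons_val_zero, Matrix.cons_val_one, Matrix.cons_val_fin_one, Int.cast_neg,
      Int.cast_natCast, eval_linePoly]
    rw [show (Fin.last 1 : Fin 2) = 1 from rfl, Rat.cast_def]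
    constructor
    · intro h
      rw [h]
      field_simp
      ring
    · intro h
      field_simp
      linear_combination h

/-- So for LINE bases the case condition is exactly non-rationality of the slope (`q ≠ 0`).
[folklore] -/
theorem mmCase_graphPolySurface_line_iff (a β : ℂ) {q : Polynomial ℂ} (hq : q ≠ 0) :
    MMCaseDimPiOneFree (graphPolySurface (linePoly a β) q) ↔ ∀ r : ℚ, a ≠ (r : ℂ) := by
  refine ⟨fun h r har => ?_, fun ha => mmCase_graphPolySurface_line ha hq⟩
  subst har
  exact not_mmCase_graphPolySurface_line_rat r β q h

end Lines

/-! ## Part 10 — corollaries through the phase criterion of `EACDensityPhases` -/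

section PhaseCorollaries

/-- **Complete answer for constant fibres over `x₁`**: for `S = {x₀ = p(x₁), y₁ = e^{z₀}}` the
exponential points are Zariski dense iff NOT all non-constant coefficients of the phase polynomial
`p(z₀ + 2πi t)` lie in `ℚ · 2πi` (transfer of `unprojectedDense_const_iff`). [folklore] -/
theorem unprojectedDense_indexSwapped_const_iff {p : Polynomial ℂ} {z₀ c : ℂ} (hc : exp z₀ = c) :
    UnprojectedDense (indexSwapped (graphPolySurface p (Polynomial.C c))) ↔
      ¬ ∀ j, 0 < j → ∃ r : ℚ, (phasePoly p z₀).coeff j = (r : ℂ) * (2 * Real.pi * I) := by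
  rw [unprojectedDense_indexSwapped_iff]
  exact unprojectedDense_const_iff hc

/-- … iff `y₀ = e^{p(x₁)}` takes infinitely many values on the exponential points. [folklore] -/
theorem unprojectedDense_indexSwapped_const_iff_infinite {p : Polynomial ℂ} {z₀ c : ℂ}
    (hc : exp z₀ = c) :
    UnprojectedDense (indexSwapped (graphPolySurface p (Polynomial.C c))) ↔
      Set.Infinite (Set.range fun k : ℤ => exp (p.eval (z₀ + k * (2 * Real.pi * I)))) := by
  rw [unprojectedDense_indexSwapped_iff]
  exact unprojectedDense_const_iff_infinite hc



/-- The phase polynomial of a line: `(a X + β)(z₀ + 2πi t) = (2πi a) t + (a z₀ + β)`. [folklore] -/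
theorem phasePoly_linePoly (a β z₀ : ℂ) :
    phasePoly (linePoly a β) z₀ = linePoly (a * (2 * Real.pi * I)) (a * z₀ + β) := by
  simp only [phasePoly, linePoly, Polynomial.add_comp, Polynomial.mul_comp, Polynomial.C_comp,
    Polynomial.X_comp, map_add, map_mul]
  ring

/-- Coefficients of the line polynomial in positive degree. [folklore] -/
theorem coeff_linePoly_of_pos (u v : ℂ) {j : ℕ} (hj : 0 < j) :
    (linePoly u v).coeff j = if j = 1 then u else 0 := by
  rw [linePoly, Polynomial.coeff_add, Polynomial.coeff_C_mul, Polynomial.coeff_X,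
    Polynomial.coeff_C, if_neg hj.ne']
  by_cases h1 : j = 1
  · subst h1; simp
  · rw [if_neg (Ne.symm h1), if_neg h1, mul_zero, add_zero]

/-- **Lines with constant fibres: dense iff the slope is not rational.** For
`S = {x₁ = a x₀ + β, y₀ = c}` (`c = e^{z₀}`) the exponential points
`(z₀ + 2πik, a z₀ + β + 2πi a k, c, e^{a z₀ + β} e^{2πi a k})` are Zariski dense in `S` iff
`a ∉ ℚ` — the degree-one case of `unprojectedDense_const_iff`. [folklore] -/
theorem unprojectedDense_line_const_iff {a β z₀ c : ℂ} (hc : exp z₀ = c) :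
    UnprojectedDense (graphPolySurface (linePoly a β) (Polynomial.C c)) ↔ ∀ r : ℚ, a ≠ (r : ℂ) := by
  rw [unprojectedDense_const_iff hc, phasePoly_linePoly]
  constructor
  · intro h r har
    apply h
    intro j hj
    rw [coeff_linePoly_of_pos _ _ hj]
    by_cases h1 : j = 1
    · exact ⟨r, by rw [if_pos h1, har]⟩
    · exact ⟨0, by rw [if_neg h1]; simp⟩
  · intro ha hall
    obtain ⟨r, hr⟩ := hall 1 one_pos
    rw [coeff_linePoly_of_pos _ _ one_pos, if_pos rfl] at hr
    exact ha r (mul_right_cancel₀ Complex.two_pi_I_ne_zero hr)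

/-- **For `{line} × {constant}` the case condition and density coincide**: both say `a ∉ ℚ`
(`c = e^{z₀} ≠ 0`). Inside this two-parameter family Mantova–Masser's question has a positive
answer for the cheapest reason: the obstruction to the case and the obstruction to density are the
same rational number. [folklore] -/
theorem mmCase_iff_unprojectedDense_line_const {a β z₀ c : ℂ} (hc : exp z₀ = c) :
    MMCaseDimPiOneFree (graphPolySurface (linePoly a β) (Polynomial.C c)) ↔
      UnprojectedDense (graphPolySurface (linePoly a β) (Polynomial.C c)) := by
  rw [mmCase_graphPolySurface_line_iff a β
      (Polynomial.C_ne_zero.2 (hc ▸ Complex.exp_ne_zero z₀)), unprojectedDense_line_const_iff hc]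

/-- In particular every line of non-rational slope with a constant fibre is a positive instance of
the question. [folklore] -/
theorem unprojectedDensityQuestion_instance_line_const {a β : ℂ} (ha : ∀ r : ℚ, a ≠ (r : ℂ))
    (z₀ : ℂ) :
    MMCaseDimPiOneFree (graphPolySurface (linePoly a β) (Polynomial.C (exp z₀))) ∧
      UnprojectedDense (graphPolySurface (linePoly a β) (Polynomial.C (exp z₀))) :=
  ⟨mmCase_graphPolySurface_line ha (Polynomial.C_ne_zero.2 (Complex.exp_ne_zero z₀)),
    (unprojectedDense_line_const_iff rfl).2 ha⟩

end PhaseCorollaries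

end Literature.ModelTheory.Zilber

end
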